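import Summits.QuantumFields.YangMills.Theorems.UnitScaleTiltProp7SymAvgTwBridge
import Summits.QuantumFields.YangMills.Theorems.UnitScaleTiltProp7SymAvgTwFrameDiff
import Summits.QuantumFields.YangMills.Theorems.UnitScaleTiltProp7CmapSymInputs
import Summits.QuantumFields.YangMills.Theorems.UnitScaleTiltProp7ChartSigmaT3OfRegPr
import HarnessLib

/-!
# `UnitScaleTiltProp7DbarTwWindow` — **(WIN-tw): THE `log` WINDOW OF THE TWISTED (DOUBLE-BAR) AVERAGE AT CHART POINTS, DISCHARGED FROM `RegPr`** — the displayed binder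
# `hwinTw` ∕ `hwin` of the EX knit v2-tw (`Prop7ChartPiecesTw.hChart_of_piecesTw`, `Prop7StubEXOfChartPiecesTw`): for a printed-regular background `U₀ ∈ 𝔘_k(ε₀)` and a bondwise
# exponent `X` of (19)-size `< e`, `‖U̿^{tw}(iX)(c) − 1‖ < 1` at every comparison bond `c` — in fact `≤ 500e + 600L(3e + 18ε₀) ≤ ¼ + 10⁻⁴` — under the (WΣ) windows of
# `Prop7ChartSigmaT3OfRegPr.chartSigmaT3_of_regPr` VERBATIM and `10⁷L³ε₀ ≤ 1`, `10⁶L²e ≤ 1` (both inside (W137) `10⁷L³·178(ε₀ + e) ≤ 1`)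
# (route `UnitScaleTilt`, crux K1 «MinimiserStabilityRegPr» stmt-QuantumFields-19200, stub `stub_existenceMinimalOrbit` (EX), route (α), node (AVG-SYM); OWNER RULING g26 KNIT v2-tw ROW LIST
# 05:19:07Z (b) + ACK 16 (b); def-free, count-neutral)

Cell `ym3-torus` (HUMAN RULING D-0037, YM ladder rung R3 — YM₃ on T³ is a rung, not d = 4, not a mass gap, not Clay), width seat `ym-ust-20520-w4` (gen 3), on the LOCATE of gen 2.

THE PRINT.  [Balaban1985Averaging] p. 31 (89): «(\overline{\overline{R(V₀)V₁}})_c = (\overline{R_{0,c₋}V₁})⁻¹(\overline{V₁V₀})_c(V̄₀)_c⁻¹R̄_{0,c}\overline{R_{0,c₊}V₁}»; p. 42 (161)–(163): «|U̿₁ʲ − 1| ≤ |Q_j| ≤ 2α₂ …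
|v_j(y) − 1| ≤ O(1)dLʲ|A|»; p. 44: «all operations needed to define R̄₀uᵏ are done always in a case where proper expressions are small».  [Balaban1985RegularSpaces] (1.31) p. 82 (the logarithm
`Q_k(U₀, ηA) := (1∕i) log U̿^{tw}` is taken inside `|· − 1| < 1`), Prop. 7 (1.139)–(1.145) p. 100.  [Balaban1985Variational] (2) p. 278, (19) p. 281, (44) p. 285.

WHAT IS PROVED (sorry-free, no definition; `M₂ = Matrix (Fin 2) (Fin 2) ℂ`, `L²`-operator norm; `η = L^{−(K−n)}`; `U̿^{tw}(A)(c) = Prop7SymAvgTw.dbarTw … U₀ A c`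
`= w_A(c₋)⁻¹·[D̄(e^{A}U₀)(c)D̄(U₀)(c)⁻¹]·[D̄(U₀)(c)w_A(c₊)D̄(U₀)(c)⁻¹]`, `Prop7SymAvgTwBridge.dbarTw_eq_conj`):
* §1 `norm_mul₃_sub_one_le` (three near-`1` factors), `norm_smul_eta_inv_le` (the rescaled exponent's reads).
* §2 ★`norm_frameTw_sub_one_le_of_regPr` — THE FRAMES: `‖w_A(y) − 1‖, ‖w_A(y)⁻¹ − 1‖ ≤ 192e` for every complex `A` with `‖A(b)‖ ≤ eη` ([Balaban1985Averaging] (163) = lit-balaban r05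
  `B8Prop7AdmittedFamily.norm_vcov_sub_one_le`, `64·d·Lᵏb` at `d = 3`, `Lᵏb = e`, read through ★w5's `Prop7SymAvgTwFrameDiff.frameTw_eq_vcov`; Prop. 7's (1.139) from `RegPr` by
  `Prop7AxialReprPrint.pdev_pull_lt ∘ inAk_pull_of_regPr`; windows `hα3 hα4 hsmall hc₃ hsm` = (WΣ) verbatim).
* §3 ★`norm_descendToGL_rel_sub_one_le_of_regPr` — THE RELATIVE DESCENDED PERTURBATION: `‖D̄(e^{A}U₀)(c)·D̄(U₀)(c)⁻¹ − 1‖ ≤ 600L(3e + 18ε₀)` (★w4 g2's (AVG-SYM-BD)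
  `Prop7SymAvgRelativeBound.norm_relIter_sub_one_le_of_plaqSmall` + `budget_T3`, through ★w1's `descendToGL = fieldShift ∘ emlIterU` and `perturbedField_eq`; every `n ≤ K`),
  `descendToGL_bgUnits_mem_specialUnitaryUnits_of_regPr` (`D̄(U₀)(c) ∈ SU(2)`, `Prop7SymAvgGLSmallOfRegPr.unitsField_toUField_descendTo_of_regPr`).
* §4 ★★`norm_dbarTw_sub_one_le_of_regPr` — `‖U̿^{tw}(A)(c) − 1‖ ≤ 500e + 600L(3e + 18ε₀)` for every complex `A` with `‖A(b)‖ ≤ eη`; ★★`norm_dbarTw_sub_one_le_of_nMax19_lt` and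
  ★★★**`dbarTw_window_of_regPr`** — FILE A's binder `hwin` LITERALLY: `nMax19 F n K U₀ X < e → ∀ c, ‖↑(dbarTw F n K h U₀ (fun b => Complex.I • X b) c) − 1‖ < 1` (also `≤ ½`);
  `dbarTw_window_of_regPr_of_w137` — the same with the two numeric windows read from (W137).  Herm-tr0 of `X` is NOT needed.
HONEST FRAMING.  Bookkeeping over landed estimates (r05's frame bound (163), ★w4 g2's relative-iterate bound, ★w1∕★w5's dictionaries); the constants `192`, `600L(3e+18ε₀)`, `500` are
this lineage's, not print's; nothing of print is asserted; the stub EX, the crux and the gap are NOT claimed.  `--supports stmt-QuantumFields-19200 --as helper`.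

References: T. Bałaban, CMP 98 (1985) 17–51 [Balaban1985Averaging] ((82) p.30, (89)–(92) p.31, (97)–(99) p.32, Prop. 4 (134)–(135) p.38, (159)–(163) p.42, p.44); CMP 99 (1985) 75–102
[Balaban1985RegularSpaces] ((1.31) p.82, Prop. 7 (1.139)–(1.145) p.100); CMP 102 (1985) 277–309 [Balaban1985Variational] ((2) p.278, (6) p.278, (19) p.281, (44) p.285); CMP 109 (1987)
249–301 [Balaban1987RG1] ((0.4) p.253).
-/

set_option autoImplicit false

noncomputable section

open scoped Matrix.Norms.L2Operator

namespace Summit.QuantumFields.YangMills.Theorems.Prop7DbarTwWindow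

open NormedSpace
open Literature.MathematicalPhysics.QuantumFieldTheory.Balaban1983to89
open Literature.MathematicalPhysics.QuantumFieldTheory.Balaban1983to89.T3ContinuumYM3Torus
open T3RegularMinimiser (regThreshold)
open T3PrintedRegularMinimiser (RegPr)
open T3SectALandauChart (eta eta_pos bgUnits)
open B7Prop1Explicit renaming Site → LSite
open B7Prop1Explicit (expUnit U1 norm_units_conj_sub_one_le)
open B7Prop2Explicit (pdev C0 c2' unitaryUnits)
open B7Prop2SpecialUnitary (specialUnitaryUnits specialUnitaryUnits_le_unitaryUnits specialUnitaryUnits_le_U1)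
open B7Prop3Flat (c3)
open B8Prop7AdmittedFamily (norm_vcov_sub_one_le)
open B8Thm2SetupTorus (unitsField_toUField_mem)
open B10Eq27TorusAxialLog (pull pull_apply transl unitsField toUField)
open T3LevelShift (fieldShift_apply bondShift)
open Summit.QuantumFields.YangMills.Theorems.Prop7SPrint (basePt)
open Summit.QuantumFields.YangMills.Theorems.Prop7TPrint (nMax19 nMax19_lt_iff)
open Summit.QuantumFields.YangMills.Theorems.Prop7SPrintIn19 (pow_mul_eta)
open Summit.QuantumFields.YangMills.Theorems.Prop7AxialReprPrint (pull_toUField_mem inAk_pull_of_regPr pdev_pull_lt)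
open Summit.QuantumFields.YangMills.Theorems.Prop8Chart (expCfg emlIterU)
open Summit.QuantumFields.YangMills.Theorems.Prop7SymAvgGL (descendToGL descendToGL_eq_fieldShift_emlIterU)
open Summit.QuantumFields.YangMills.Theorems.Prop7SymAvgGLSmallOfRegPr (bgUnits_eq unitsField_toUField_descendTo_of_regPr)
open Summit.QuantumFields.YangMills.Theorems.Prop7SymAvgRelativeBound (perturbedField_eq budget_T3 norm_relIter_sub_one_le_of_plaqSmall)
open Summit.QuantumFields.YangMills.Theorems.Prop7SymAvgTw (frameTw dbarTw)
open Summit.QuantumFields.YangMills.Theorems.Prop7SymAvgTwFrameDiff (frameTw_eq_vcov)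
open Summit.QuantumFields.YangMills.Theorems.Prop7SymAvgTwBridge (dbarTw_eq_conj)

/-! ## §1 Two elementary letters -/

/-- **THREE NEAR-`1` FACTORS**: `‖a − 1‖ ≤ x`, `‖m − 1‖ ≤ y`, `‖g − 1‖ ≤ z` ⟹ `‖a·m·g − 1‖ ≤ (1 + x)(1 + y)(1 + z) − 1` (any normed ring). [folklore] -/
theorem norm_mul₃_sub_one_le {𝔸 : Type*} [NormedRing 𝔸] {a m g : 𝔸} {x y z : ℝ} (ha : ‖a - 1‖ ≤ x) (hm : ‖m - 1‖ ≤ y) (hg : ‖g - 1‖ ≤ z) :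
    ‖a * m * g - 1‖ ≤ (1 + x) * (1 + y) * (1 + z) - 1 := by
  have hx : 0 ≤ x := (norm_nonneg _).trans ha
  have hy : 0 ≤ y := (norm_nonneg _).trans hm
  have hz : 0 ≤ z := (norm_nonneg _).trans hg
  have e1 : a * m * g - 1
      = (a - 1) * (m - 1) * (g - 1) + (a - 1) * (m - 1) + (a - 1) * (g - 1) + (m - 1) * (g - 1) + (a - 1) + (m - 1) + (g - 1) := by
    noncomm_ring
  rw [e1]
  have h3 : ‖(a - 1) * (m - 1) * (g - 1)‖ ≤ x * y * z :=
    (norm_mul_le _ _).trans (mul_le_mul ((norm_mul_le _ _).trans (mul_le_mul ha hm (norm_nonneg _) hx)) hg (norm_nonneg _) (mul_nonneg hx hy))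
  have ham : ‖(a - 1) * (m - 1)‖ ≤ x * y := (norm_mul_le _ _).trans (mul_le_mul ha hm (norm_nonneg _) hx)
  have hag : ‖(a - 1) * (g - 1)‖ ≤ x * z := (norm_mul_le _ _).trans (mul_le_mul ha hg (norm_nonneg _) hx)
  have hmg : ‖(m - 1) * (g - 1)‖ ≤ y * z := (norm_mul_le _ _).trans (mul_le_mul hm hg (norm_nonneg _) hy)
  calc _ ≤ ‖(a - 1) * (m - 1) * (g - 1)‖ + ‖(a - 1) * (m - 1)‖ + ‖(a - 1) * (g - 1)‖ + ‖(m - 1) * (g - 1)‖ + ‖a - 1‖ + ‖m - 1‖ + ‖g - 1‖ := by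
        refine (norm_add_le _ _).trans (add_le_add (norm_add_le _ _ |>.trans (add_le_add (norm_add_le _ _ |>.trans (add_le_add
          (norm_add_le _ _ |>.trans (add_le_add (norm_add_le _ _ |>.trans (add_le_add (norm_add_le _ _) le_rfl)) le_rfl)) le_rfl)) le_rfl)) le_rfl)
    _ ≤ x * y * z + x * y + x * z + y * z + x + y + z := by linarith
    _ = (1 + x) * (1 + y) * (1 + z) - 1 := by ring

variable (F : T3Family) {n K : ℕ} (h : n ≤ K)

/-- **THE READS OF THE RESCALED EXPONENT**: with `η = L^{−(K−n)}` and `A″ := (iη)⁻¹A`, `‖η·A″(b)‖ = ‖A(b)‖`; so `‖A(b)‖ ≤ e·η` gives `‖η·A″(b)‖ ≤ η·e`. [folklore] -/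
theorem norm_smul_eta_inv_le {η e : ℝ} (hη : η ≠ 0) (A : PBond (F.P K) 0 → Matrix (Fin 2) (Fin 2) ℂ) (hA : ∀ b, ‖A b‖ ≤ e * η) (b : PBond (F.P K) 0) :
    ‖(η : ℂ) • ((Complex.I * (η : ℂ))⁻¹ • A b)‖ ≤ η * e := by
  have hηC : (η : ℂ) ≠ 0 := by exact_mod_cast hη
  have h1 : (η : ℂ) * (Complex.I * (η : ℂ))⁻¹ = Complex.I⁻¹ := by
    field_simp
  rw [smul_smul, h1, norm_smul, norm_inv, Complex.norm_I, inv_one, one_mul, mul_comm]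
  exact hA b

/-! ## §2 The accumulated comb frames of the perturbation are within `192e` of `1` -/

/-- ★ **THE FRAMES `w_A(y) = \overline{R_{0,y}e^{A}}^{(k)}` AND THEIR INVERSES ARE WITHIN `192e` OF `1`** at a printed-regular background `U₀ ∈ 𝔘_k(ε₀)`, for every COMPLEX bondwise
exponent `A` with `‖A(b)‖ ≤ e·η` (`η = L^{−(K−n)}`), under r05's Prop-7 windows at `α₀ = 2ε₀`, `Lᵏb = e` — (WΣ) verbatim: lit-balaban `B8Prop7AdmittedFamily.norm_vcov_sub_one_le`
(«|v_j(y) − 1|, |v_j(y)⁻¹ − 1| ≤ 64dLʲb», [Balaban1985Averaging] (163)) at `j = k = K − n`, `d = 3`, read through `frameTw = vcov` (★w5) on the based pullbacks, (1.139) for `U₀♯` from `RegPr`.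
[cite: Balaban1985Averaging, (163) p.42, (97)–(99) p.32, (82) p.30; Balaban1985RegularSpaces, Prop. 7 (1.139) p.100; Balaban1985Variational, (2) p.278, (19) p.281] -/
theorem norm_frameTw_sub_one_le_of_regPr {ε₀ e : ℝ} (hε₀ : 0 < ε₀) (he : 0 ≤ e)
    (hα3 : C0 (F.P K).d * (2 * ε₀) ≤ 1 / 3) (hα4 : 4 * (2 * ε₀) ≤ c2' (F.P K).d (F.P K).L)
    (hsmall : Real.exp (4 * (800 * (((F.P K).d : ℝ) + 1) ^ 2 * (((F.P K).d : ℝ) + 4)) * (2 * ε₀))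
      * (1 + 8 * (131072 * (((F.P K).d : ℝ) + 1) ^ 2) * e) ≤ 2)
    (hc₃ : 2 * e ≤ c3 (F.P K).d (F.P K).L) (hsm : 2048 * ((F.P K).d : ℝ) * e ≤ 1)
    (U₀ : GaugeField (F.P K) 0 (Matrix.specialUnitaryGroup (Fin 2) ℂ)) (hreg : RegPr F n K ε₀ U₀)
    (A : PBond (F.P K) 0 → Matrix (Fin 2) (Fin 2) ℂ) (hA : ∀ b, ‖A b‖ ≤ e * eta F n K) (y : Site (F.P n) 0) :
    ‖((frameTw F n K h U₀ A y : (Matrix (Fin 2) (Fin 2) ℂ)ˣ) : Matrix (Fin 2) (Fin 2) ℂ) - 1‖ ≤ 192 * e ∧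
      ‖(((frameTw F n K h U₀ A y)⁻¹ : (Matrix (Fin 2) (Fin 2) ℂ)ˣ) : Matrix (Fin 2) (Fin 2) ℂ) - 1‖ ≤ 192 * e := by
  letI : CStarAlgebra (Matrix (Fin 2) (Fin 2) ℂ) := B10Eq29TubeLine.cstarAlgebraMatrix 2
  have hL2 : 2 ≤ (F.P K).L := (F.P K).hL.2
  have hd3 : ((F.P K).d : ℝ) = 3 := by exact_mod_cast T3Family.P_d F K
  have hη : 0 < eta F n K := eta_pos F n K
  have hLη : ((F.P K).L : ℝ) ^ (K - n) * eta F n K = 1 := pow_mul_eta F n K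
  have hLb : ((F.P K).L : ℝ) ^ (K - n) * (e * eta F n K) = e := by rw [mul_left_comm, hLη, mul_one]
  -- r05's tower data read from `RegPr` on the based pullbacks
  have hU₀ : ∀ (z : LSite (F.P K).d) (κ : Fin (F.P K).d), pull (bgUnits F K U₀) (basePt F n K) z κ ∈ unitaryUnits (Matrix (Fin 2) (Fin 2) ℂ) := fun z κ =>
    specialUnitaryUnits_le_unitaryUnits (by rw [bgUnits_eq]; exact pull_toUField_mem U₀ _ z κ)
  have h52 : pdev (pull (bgUnits F K U₀) (basePt F n K)) < 2 * ε₀ * ((((F.P K).L : ℝ) ^ (K - n))⁻¹) ^ 2 := by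
    rw [bgUnits_eq]; exact pdev_pull_lt (P := F.P K) hε₀ (inAk_pull_of_regPr F (n := n) (K := K) hε₀.le hreg) (basePt F n K)
  have hα : 0 < 2 * ε₀ := by positivity
  have hb : 0 ≤ e * eta F n K := by positivity
  have hB : ∀ (z : LSite (F.P K).d) (κ : Fin (F.P K).d), ‖A ⟨transl (basePt F n K) z, κ⟩‖ ≤ e * eta F n K := fun z κ => hA _
  obtain ⟨h1, h2⟩ := norm_vcov_sub_one_le (k := K - n) (B := fun z κ => A ⟨transl (basePt F n K) z, κ⟩) hL2 hU₀ hα hα3 hα4 h52 hb hB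
    (by rw [hLb]; exact hsmall) (by rw [hLb]; exact hc₃) (by rw [hLb]; exact hsm) le_rfl (Prop7SymAvgTw.coordT3 F n K h y)
  rw [hLb, hd3] at h1 h2
  rw [frameTw_eq_vcov]
  exact ⟨h1.trans (by linarith), h2.trans (by linarith)⟩

/-! ## §3 The relative descended perturbation is within `600L(3e + 18ε₀)` of `1`; the descended background is `SU(2)`-valued -/

/-- ★ **THE RELATIVE DESCENDED PERTURBATION `D̄(e^{A}U₀)(c)·D̄(U₀)(c)⁻¹` IS WITHIN `600L(3e + 18ε₀)` OF `1`** at every comparison bond `c`, for `U₀ ∈ 𝔘_k(ε₀)` with `10⁷L³ε₀ ≤ 1` and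
every complex bondwise `A` with `‖A(b)‖ ≤ e·η`, `10⁶L²e ≤ 1` (★w4 g2's (AVG-SYM-BD) `norm_relIter_sub_one_le_of_plaqSmall` at the T³ letters: `descendToGL = fieldShift ∘ emlIterU (K − n)`,
`e^{A}U₀♭ = e^{iηA″}U₀♭` with `A″ = (iη)⁻¹A`, budget `budget_T3` at `r := e`; EVERY `n ≤ K`, the case `n = K` included).
[cite: Balaban1985Averaging, Prop. 4 (134)–(135) p.38; Balaban1985Variational, (6) p.278, (44) p.285; Balaban1987RG1, (0.4) p.253] -/
theorem norm_descendToGL_rel_sub_one_le_of_regPr {ε₀ e : ℝ} (hε₀ : 0 < ε₀) (he : 0 ≤ e)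
    (hε : 10 ^ 7 * (F.L : ℝ) ^ 3 * ε₀ ≤ 1) (he6 : 10 ^ 6 * (F.L : ℝ) ^ 2 * e ≤ 1)
    (U₀ : GaugeField (F.P K) 0 (Matrix.specialUnitaryGroup (Fin 2) ℂ)) (hreg : RegPr F n K ε₀ U₀)
    (A : PBond (F.P K) 0 → Matrix (Fin 2) (Fin 2) ℂ) (hA : ∀ b, ‖A b‖ ≤ e * eta F n K) (c : PBond (F.P n) 0) :
    ‖((descendToGL F n K h (fun b => expUnit (A b) * bgUnits F K U₀ b) c : (Matrix (Fin 2) (Fin 2) ℂ)ˣ) : Matrix (Fin 2) (Fin 2) ℂ) *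
          (((descendToGL F n K h (bgUnits F K U₀) c)⁻¹ : (Matrix (Fin 2) (Fin 2) ℂ)ˣ) : Matrix (Fin 2) (Fin 2) ℂ) - 1‖
      ≤ 600 * (F.L : ℝ) * (3 * e + 18 * ε₀) := by
  -- letters
  have hd : (F.P K).d = 3 := T3Family.P_d F K
  have hLL : ((F.P K).L : ℝ) = F.L := rfl
  have hL3 : 3 ≤ F.L := by obtain ⟨a, ha⟩ := F.hL.1; have := F.hL.2; omega
  have hL0 : (0 : ℝ) < F.L := by exact_mod_cast (show 0 < F.L by omega)
  have hk1 : K - n + 1 ≤ (F.P K).m + (F.P K).K := by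
    show K - n + 1 ≤ F.m + K; have := F.hm; omega
  set η : ℝ := ((F.L : ℝ)⁻¹) ^ (K - n) with hη
  have hη0 : 0 < η := by positivity
  have hηne : η ≠ 0 := hη0.ne'
  have hηeta : eta F n K = η := rfl
  -- the plaquette window of `RegPr`: `a₀ = ε₀L^{−2k}`, `X²a₀ = ε₀`
  set a₀ : ℝ := regThreshold F n K ε₀ with ha₀
  have ha₀0 : 0 < a₀ := by rw [ha₀]; unfold regThreshold; positivity
  have hXa : (F.L : ℝ) ^ (K - n) * ((F.L : ℝ) ^ (K - n) * a₀) = ε₀ := by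
    have hX2 : (F.L : ℝ) ^ (K - n) * (F.L : ℝ) ^ (K - n) = (F.L : ℝ) ^ (2 * (K - n)) := by rw [← pow_add, two_mul]
    have ha : a₀ = ε₀ * ((F.L : ℝ) ^ (2 * (K - n)))⁻¹ := by rw [ha₀]; unfold regThreshold; rw [inv_pow]
    rw [← mul_assoc, hX2, ha, mul_comm ε₀, ← mul_assoc, mul_inv_cancel₀ (pow_ne_zero _ hL0.ne'), one_mul]
  have hU := hreg.1
  obtain ⟨ht1, hbudget, hbound, -⟩ := budget_T3 F (K - n) hε₀ hε he he6 ha₀0.le hXa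
  -- the reads of the rescaled exponent `A″ = (iη)⁻¹A`: `‖ηA″(b)‖ ≤ ηe`
  have hA' : ∀ b, ‖(η : ℂ) • ((fun b => (Complex.I * (η : ℂ))⁻¹ • A b) b)‖ ≤ η * e := fun b =>
    norm_smul_eta_inv_le F hηne A (fun b => by rw [← hηeta]; exact hA b) b
  -- the dictionary: `descendToGL = fieldShift ∘ emlIterU`, `e^{A}U₀♭ = e^{iηA″}U₀♭`
  rw [perturbedField_eq F K hηne U₀ A, bgUnits_eq, descendToGL_eq_fieldShift_emlIterU, descendToGL_eq_fieldShift_emlIterU, fieldShift_apply, fieldShift_apply]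
  have h1 := norm_relIter_sub_one_le_of_plaqSmall hk1 U₀ ha₀0 hU η (fun b => (Complex.I * (η : ℂ))⁻¹ • A b) ht1 hA' (by rw [hd, hLL]; exact hbudget)
    (bondShift (F.sitesPerDir_eq (m := F.m) (K := n) (j := 0) (m' := F.m) (K' := K) (j' := K - n) (by omega)) c)
  rw [hd, hLL] at h1
  exact h1.trans hbound

/-- **THE DESCENDED BACKGROUND `D̄(U₀)(c)` IS `SU(2)`-VALUED** on `𝔘_k(ε₀)` (`10⁷L³ε₀ ≤ 1`): `descendToGL (U₀♭)(c) = (D_{n,K}U₀)♭(c)` (`Prop7SymAvgGLSmallOfRegPr.unitsField_toUField_descendTo_of_regPr`).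
[cite: Balaban1987RG1, (0.4) p.253; Balaban1985Variational, (2) p.278, (6) p.278] -/
theorem descendToGL_bgUnits_mem_specialUnitaryUnits_of_regPr {ε₀ : ℝ} (hε₀ : 0 < ε₀) (hε : 10 ^ 7 * (F.L : ℝ) ^ 3 * ε₀ ≤ 1)
    (U₀ : GaugeField (F.P K) 0 (Matrix.specialUnitaryGroup (Fin 2) ℂ)) (hreg : RegPr F n K ε₀ U₀) (c : PBond (F.P n) 0) :
    descendToGL F n K h (bgUnits F K U₀) c ∈ specialUnitaryUnits (Fin 2) := by
  rw [bgUnits_eq, ← unitsField_toUField_descendTo_of_regPr F h hε₀ hε hreg]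
  exact unitsField_toUField_mem _ c

/-! ## §4 ★ (WIN-tw): the twisted average at chart points is inside the `log` window -/

/-- ★★ **`‖U̿^{tw}(A)(c) − 1‖ ≤ 500e + 600L(3e + 18ε₀)`** for `U₀ ∈ 𝔘_k(ε₀)` and every COMPLEX bondwise `A` with `‖A(b)‖ ≤ e·η`, under `10⁷L³ε₀ ≤ 1`, `10⁶L²e ≤ 1` and (WΣ): the
factorisation `U̿^{tw}(A)(c) = w(c₋)⁻¹·[D̄(e^{A}U₀)D̄(U₀)⁻¹](c)·[D̄(U₀)(c)w(c₊)D̄(U₀)(c)⁻¹]` (`dbarTw_eq_conj`), §2 for the two frames (`192e` each; `D̄(U₀)(c) ∈ SU(2)` conjugates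
isometrically, `B7Prop1Explicit.norm_units_conj_sub_one_le`), §3 for the middle factor, and `(1 + x)(1 + y)(1 + z) − 1 ≤ 500e + y` for `x = z = 192e ≤ 192·10⁻⁶`, `y ≤ ¼`.
[cite: Balaban1985Averaging, (89) p.31, (161)–(163) p.42, p.44; Balaban1985RegularSpaces, (1.31) p.82, Prop. 7 p.100; Balaban1985Variational, (44) p.285] -/
theorem norm_dbarTw_sub_one_le_of_regPr {ε₀ e : ℝ} (hε₀ : 0 < ε₀) (he : 0 ≤ e)
    (hε : 10 ^ 7 * (F.L : ℝ) ^ 3 * ε₀ ≤ 1) (he6 : 10 ^ 6 * (F.L : ℝ) ^ 2 * e ≤ 1)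
    (hα3 : C0 (F.P K).d * (2 * ε₀) ≤ 1 / 3) (hα4 : 4 * (2 * ε₀) ≤ c2' (F.P K).d (F.P K).L)
    (hsmall : Real.exp (4 * (800 * (((F.P K).d : ℝ) + 1) ^ 2 * (((F.P K).d : ℝ) + 4)) * (2 * ε₀))
      * (1 + 8 * (131072 * (((F.P K).d : ℝ) + 1) ^ 2) * e) ≤ 2)
    (hc₃ : 2 * e ≤ c3 (F.P K).d (F.P K).L) (hsm : 2048 * ((F.P K).d : ℝ) * e ≤ 1)
    (U₀ : GaugeField (F.P K) 0 (Matrix.specialUnitaryGroup (Fin 2) ℂ)) (hreg : RegPr F n K ε₀ U₀)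
    (A : PBond (F.P K) 0 → Matrix (Fin 2) (Fin 2) ℂ) (hA : ∀ b, ‖A b‖ ≤ e * eta F n K) (c : PBond (F.P n) 0) :
    ‖((dbarTw F n K h U₀ A c : (Matrix (Fin 2) (Fin 2) ℂ)ˣ) : Matrix (Fin 2) (Fin 2) ℂ) - 1‖ ≤ 500 * e + 600 * (F.L : ℝ) * (3 * e + 18 * ε₀) := by
  have hL3 : 3 ≤ F.L := by obtain ⟨a, ha⟩ := F.hL.1; have := F.hL.2; omega
  have hL3r : (3 : ℝ) ≤ F.L := by exact_mod_cast hL3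
  -- the three factors
  obtain ⟨-, hwm⟩ := norm_frameTw_sub_one_le_of_regPr F h hε₀ he hα3 hα4 hsmall hc₃ hsm U₀ hreg A hA c.src
  obtain ⟨hwp, -⟩ := norm_frameTw_sub_one_le_of_regPr F h hε₀ he hα3 hα4 hsmall hc₃ hsm U₀ hreg A hA c.tgt
  have hmid := norm_descendToGL_rel_sub_one_le_of_regPr F h hε₀ he hε he6 U₀ hreg A hA c
  have hD₀ : descendToGL F n K h (bgUnits F K U₀) c ∈ U1 (Matrix (Fin 2) (Fin 2) ℂ) :=
    specialUnitaryUnits_le_U1 (descendToGL_bgUnits_mem_specialUnitaryUnits_of_regPr F h hε₀ hε U₀ hreg c)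
  have hconj : ‖((descendToGL F n K h (bgUnits F K U₀) c : (Matrix (Fin 2) (Fin 2) ℂ)ˣ) : Matrix (Fin 2) (Fin 2) ℂ)
        * ((frameTw F n K h U₀ A c.tgt : (Matrix (Fin 2) (Fin 2) ℂ)ˣ) : Matrix (Fin 2) (Fin 2) ℂ)
        * (((descendToGL F n K h (bgUnits F K U₀) c)⁻¹ : (Matrix (Fin 2) (Fin 2) ℂ)ˣ) : Matrix (Fin 2) (Fin 2) ℂ) - 1‖ ≤ 192 * e :=
    (norm_units_conj_sub_one_le hD₀ _).trans hwp
  -- the budget of the middle factor: `600L(3e + 18ε₀) ≤ ¼`, and `192e ≤ 192∕(9·10⁶)`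
  have hy : 600 * (F.L : ℝ) * (3 * e + 18 * ε₀) ≤ 1 / 4 := by
    have hL0 : (0 : ℝ) < F.L := by linarith
    have hk : (F.L : ℝ) ^ (K - n) * ((F.L : ℝ) ^ (K - n) * (ε₀ * (((F.L : ℝ) ^ (K - n)) ^ 2)⁻¹)) = ε₀ := by
      field_simp
    exact (budget_T3 F (K - n) hε₀ hε he he6 (a₀ := ε₀ * (((F.L : ℝ) ^ (K - n)) ^ 2)⁻¹) (by positivity) hk).2.2.2
  have hx : 192 * e ≤ 1 / 40000 := by
    have h9 : (9 : ℝ) ≤ (F.L : ℝ) ^ 2 := by nlinarith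
    nlinarith
  rw [dbarTw_eq_conj]
  simp only [Units.val_mul]
  refine (norm_mul₃_sub_one_le hwm hmid hconj).trans ?_
  have hy0 : 0 ≤ 600 * (F.L : ℝ) * (3 * e + 18 * ε₀) := by positivity
  nlinarith [mul_nonneg (mul_nonneg he he) hy0, mul_nonneg he hy0, mul_nonneg he he]

/-- The first clause of (19): `nMax19 U₀ X < e` gives `‖X(b)‖ ≤ e·η` bondwise, and the same for `iX`. [cite: Balaban1985Variational, (19) p.281] -/
theorem norm_smul_I_le_of_nMax19_lt {e : ℝ} {U₀ : GaugeField (F.P K) 0 (Matrix.specialUnitaryGroup (Fin 2) ℂ)} {X : PBond (F.P K) 0 → Matrix (Fin 2) (Fin 2) ℂ}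
    (hX : nMax19 F n K U₀ X < e) (b : PBond (F.P K) 0) : ‖Complex.I • X b‖ ≤ e * eta F n K := by
  rw [norm_smul, Complex.norm_I, one_mul]
  exact (((nMax19_lt_iff (F := F) (n := n) (K := K)).1 hX).1 b).le

/-- ★★ **`‖U̿^{tw}(iX)(c) − 1‖ ≤ 500e + 600L(3e + 18ε₀)` AT CHART POINTS OF (19)-SIZE `< e`** (§4's bound at `A := iX`, the size from `nMax19_lt_iff` clause 1; `X` need not be Hermitian).
[cite: Balaban1985Variational, (19) p.281, (44) p.285; Balaban1985Averaging, (89) p.31, (161)–(163) p.42] -/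
theorem norm_dbarTw_sub_one_le_of_nMax19_lt {ε₀ e : ℝ} (hε₀ : 0 < ε₀) (he : 0 < e)
    (hε : 10 ^ 7 * (F.L : ℝ) ^ 3 * ε₀ ≤ 1) (he6 : 10 ^ 6 * (F.L : ℝ) ^ 2 * e ≤ 1)
    (hα3 : C0 (F.P K).d * (2 * ε₀) ≤ 1 / 3) (hα4 : 4 * (2 * ε₀) ≤ c2' (F.P K).d (F.P K).L)
    (hsmall : Real.exp (4 * (800 * (((F.P K).d : ℝ) + 1) ^ 2 * (((F.P K).d : ℝ) + 4)) * (2 * ε₀))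
      * (1 + 8 * (131072 * (((F.P K).d : ℝ) + 1) ^ 2) * e) ≤ 2)
    (hc₃ : 2 * e ≤ c3 (F.P K).d (F.P K).L) (hsm : 2048 * ((F.P K).d : ℝ) * e ≤ 1)
    (U₀ : GaugeField (F.P K) 0 (Matrix.specialUnitaryGroup (Fin 2) ℂ)) (hreg : RegPr F n K ε₀ U₀)
    (X : PBond (F.P K) 0 → Matrix (Fin 2) (Fin 2) ℂ) (hX : nMax19 F n K U₀ X < e) (c : PBond (F.P n) 0) :
    ‖((dbarTw F n K h U₀ (fun b => Complex.I • X b) c : (Matrix (Fin 2) (Fin 2) ℂ)ˣ) : Matrix (Fin 2) (Fin 2) ℂ) - 1‖ ≤ 500 * e + 600 * (F.L : ℝ) * (3 * e + 18 * ε₀) :=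
  norm_dbarTw_sub_one_le_of_regPr F h hε₀ he.le hε he6 hα3 hα4 hsmall hc₃ hsm U₀ hreg (fun b => Complex.I • X b) (norm_smul_I_le_of_nMax19_lt F hX) c

/-- ★★ **THE HALF WINDOW**: under the same hypotheses `‖U̿^{tw}(iX)(c) − 1‖ ≤ ½` (`500e ≤ 5·10⁻⁴∕L²`, `600L(3e + 18ε₀) ≤ ¼` by `budget_T3`). The form the `log`-series estimates
(`MatrixLog.norm_mlog_le_two_mul`-type) consume. [cite: Balaban1985RegularSpaces, (1.31) p.82; Balaban1985Averaging, (22)–(24) p.21, (161) p.42] -/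
theorem norm_dbarTw_sub_one_le_half_of_regPr {ε₀ e : ℝ} (hε₀ : 0 < ε₀) (he : 0 < e)
    (hε : 10 ^ 7 * (F.L : ℝ) ^ 3 * ε₀ ≤ 1) (he6 : 10 ^ 6 * (F.L : ℝ) ^ 2 * e ≤ 1)
    (hα3 : C0 (F.P K).d * (2 * ε₀) ≤ 1 / 3) (hα4 : 4 * (2 * ε₀) ≤ c2' (F.P K).d (F.P K).L)
    (hsmall : Real.exp (4 * (800 * (((F.P K).d : ℝ) + 1) ^ 2 * (((F.P K).d : ℝ) + 4)) * (2 * ε₀))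
      * (1 + 8 * (131072 * (((F.P K).d : ℝ) + 1) ^ 2) * e) ≤ 2)
    (hc₃ : 2 * e ≤ c3 (F.P K).d (F.P K).L) (hsm : 2048 * ((F.P K).d : ℝ) * e ≤ 1)
    (U₀ : GaugeField (F.P K) 0 (Matrix.specialUnitaryGroup (Fin 2) ℂ)) (hreg : RegPr F n K ε₀ U₀)
    (X : PBond (F.P K) 0 → Matrix (Fin 2) (Fin 2) ℂ) (hX : nMax19 F n K U₀ X < e) (c : PBond (F.P n) 0) :
    ‖((dbarTw F n K h U₀ (fun b => Complex.I • X b) c : (Matrix (Fin 2) (Fin 2) ℂ)ˣ) : Matrix (Fin 2) (Fin 2) ℂ) - 1‖ ≤ 1 / 2 := by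
  have hL3 : 3 ≤ F.L := by obtain ⟨a, ha⟩ := F.hL.1; have := F.hL.2; omega
  have hL3r : (3 : ℝ) ≤ F.L := by exact_mod_cast hL3
  have hL0 : (0 : ℝ) < F.L := by linarith
  have hk : (F.L : ℝ) ^ (K - n) * ((F.L : ℝ) ^ (K - n) * (ε₀ * (((F.L : ℝ) ^ (K - n)) ^ 2)⁻¹)) = ε₀ := by
    field_simp
  have hy := (budget_T3 F (K - n) hε₀ hε he.le he6 (a₀ := ε₀ * (((F.L : ℝ) ^ (K - n)) ^ 2)⁻¹) (by positivity) hk).2.2.2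
  have hx : 500 * e ≤ 1 / 10000 := by
    have h9 : (9 : ℝ) ≤ (F.L : ℝ) ^ 2 := by nlinarith
    nlinarith
  exact (norm_dbarTw_sub_one_le_of_nMax19_lt F h hε₀ he hε he6 hα3 hα4 hsmall hc₃ hsm U₀ hreg X hX c).trans (by linarith)

/-- ★★★ **(WIN-tw) — FILE A's BINDER `hwin`, DISCHARGED FROM `RegPr`**: for `U₀ ∈ 𝔘_k(ε₀)` (`RegPr F n K ε₀ U₀`), `10⁷L³ε₀ ≤ 1`, `10⁶L²e ≤ 1` and the (WΣ) windows of
`chartSigmaT3_of_regPr` VERBATIM (`hα3 hα4 hsmall hc₃ hsm`), every bondwise `X` of (19)-size `nMax19 F n K U₀ X < e` has its twisted (double-bar) average INSIDE THE `log` WINDOW at every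
comparison bond: `‖↑(dbarTw F n K h U₀ (fun b => Complex.I • X b) c) − 1‖ < 1` ([Balaban1985RegularSpaces] (1.31): «Q_k(U₀, ηA) := (1∕i) log U̿» is defined; print p. 44: «proper expressions are
small»).  The Hermitian-traceless hypothesis of the knit's binder is not needed and may be discarded by the consumer (`fun X _ hX c => dbarTw_window_of_regPr … X hX c`).
[cite: Balaban1985RegularSpaces, (1.31) p.82, Prop. 7 (1.139)–(1.145) p.100; Balaban1985Averaging, (89)–(92) p.31, (161)–(163) p.42, p.44; Balaban1985Variational, (19) p.281, (44) p.285] -/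
theorem dbarTw_window_of_regPr {ε₀ e : ℝ} (hε₀ : 0 < ε₀) (he : 0 < e)
    (hε : 10 ^ 7 * (F.L : ℝ) ^ 3 * ε₀ ≤ 1) (he6 : 10 ^ 6 * (F.L : ℝ) ^ 2 * e ≤ 1)
    (hα3 : C0 (F.P K).d * (2 * ε₀) ≤ 1 / 3) (hα4 : 4 * (2 * ε₀) ≤ c2' (F.P K).d (F.P K).L)
    (hsmall : Real.exp (4 * (800 * (((F.P K).d : ℝ) + 1) ^ 2 * (((F.P K).d : ℝ) + 4)) * (2 * ε₀))
      * (1 + 8 * (131072 * (((F.P K).d : ℝ) + 1) ^ 2) * e) ≤ 2)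
    (hc₃ : 2 * e ≤ c3 (F.P K).d (F.P K).L) (hsm : 2048 * ((F.P K).d : ℝ) * e ≤ 1)
    (U₀ : GaugeField (F.P K) 0 (Matrix.specialUnitaryGroup (Fin 2) ℂ)) (hreg : RegPr F n K ε₀ U₀)
    (X : PBond (F.P K) 0 → Matrix (Fin 2) (Fin 2) ℂ) (hX : nMax19 F n K U₀ X < e) (c : PBond (F.P n) 0) :
    ‖((dbarTw F n K h U₀ (fun b => Complex.I • X b) c : (Matrix (Fin 2) (Fin 2) ℂ)ˣ) : Matrix (Fin 2) (Fin 2) ℂ) - 1‖ < 1 :=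
  (norm_dbarTw_sub_one_le_half_of_regPr F h hε₀ he hε he6 hα3 hα4 hsmall hc₃ hsm U₀ hreg X hX c).trans_lt (by norm_num)

/-- ★★★ **(WIN-tw) WITH THE TWO NUMERIC WINDOWS READ FROM (W137)** `10⁷L³·178(ε₀ + e) ≤ 1` (the knit's `hw137`; it implies `10⁷L³ε₀ ≤ 1` and `10⁶L²e ≤ 1`): the member-level `hwin` of
`Prop7ChartPiecesTw.hChart_of_piecesTw` in the knit's own letters. [cite: Balaban1985RegularSpaces, (1.31) p.82, Prop. 7 p.100; Balaban1985Averaging, (89) p.31, (161)–(163) p.42; Balaban1985Variational, (19) p.281] -/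
theorem dbarTw_window_of_regPr_of_w137 {ε₀ e : ℝ} (hε₀ : 0 < ε₀) (he : 0 < e)
    (hw137 : 10 ^ 7 * (F.L : ℝ) ^ 3 * (178 * (ε₀ + e)) ≤ 1)
    (hα3 : C0 (F.P K).d * (2 * ε₀) ≤ 1 / 3) (hα4 : 4 * (2 * ε₀) ≤ c2' (F.P K).d (F.P K).L)
    (hsmall : Real.exp (4 * (800 * (((F.P K).d : ℝ) + 1) ^ 2 * (((F.P K).d : ℝ) + 4)) * (2 * ε₀))
      * (1 + 8 * (131072 * (((F.P K).d : ℝ) + 1) ^ 2) * e) ≤ 2)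
    (hc₃ : 2 * e ≤ c3 (F.P K).d (F.P K).L) (hsm : 2048 * ((F.P K).d : ℝ) * e ≤ 1)
    (U₀ : GaugeField (F.P K) 0 (Matrix.specialUnitaryGroup (Fin 2) ℂ)) (hreg : RegPr F n K ε₀ U₀)
    (X : PBond (F.P K) 0 → Matrix (Fin 2) (Fin 2) ℂ) (hX : nMax19 F n K U₀ X < e) (c : PBond (F.P n) 0) :
    ‖((dbarTw F n K h U₀ (fun b => Complex.I • X b) c : (Matrix (Fin 2) (Fin 2) ℂ)ˣ) : Matrix (Fin 2) (Fin 2) ℂ) - 1‖ < 1 := by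
  have hL3 : 3 ≤ F.L := by obtain ⟨a, ha⟩ := F.hL.1; have := F.hL.2; omega
  have hL3r : (3 : ℝ) ≤ F.L := by exact_mod_cast hL3
  have hL2 : (9 : ℝ) ≤ (F.L : ℝ) ^ 2 := by nlinarith
  have hL23 : (F.L : ℝ) ^ 2 ≤ (F.L : ℝ) ^ 3 := by nlinarith
  have h3 : (0 : ℝ) ≤ (F.L : ℝ) ^ 3 := by positivity
  have hε : 10 ^ 7 * (F.L : ℝ) ^ 3 * ε₀ ≤ 1 := by nlinarith [mul_nonneg h3 he.le, mul_nonneg h3 hε₀.le]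
  have he6 : 10 ^ 6 * (F.L : ℝ) ^ 2 * e ≤ 1 := by nlinarith [mul_nonneg h3 he.le, mul_nonneg h3 hε₀.le, mul_nonneg (sub_nonneg.2 hL23) he.le]
  exact dbarTw_window_of_regPr F h hε₀ he hε he6 hα3 hα4 hsmall hc₃ hsm U₀ hreg X hX c

end Summit.QuantumFields.YangMills.Theorems.Prop7DbarTwWindow

end
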